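import Literature.NumberTheory.GaloisRepresentations.TameInertia
import Literature.NumberTheory.GaloisRepresentations.ModPGaloisRepProofs
import HarnessLib

/-!
# Discharges for `TameInertia.lean`, I: the wild inertia group is pro-`p` (trunk GalRep)

D-0014 keeps `Literature/` sorry-free by stating cited results as named facts `def X : Prop`.
This sibling file of `Literature.NumberTheory.GaloisRepresentations.TameInertia` proves the
named fact

* `Literature.absUpperInertia_map_isPGroup_holds : absUpperInertia_map_isPGroup F H` — for `v > 0`
  the image of `I_F^v` under a continuous homomorphism `Γ_F → H` into a discrete group is a
  `p`-group (Serre, *Local Fields*, Ch. IV §2, Cor. 3 of Prop. 7 with §3, Remark 1),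

as `theorem X_holds : X` (users holding `(h : X)` are fed `X_holds`), through:

* `Ideal.isPGroup_ramificationSubgroup_one` — **`G_1` is a `p`-group**: for a finite group `G`
  acting faithfully by ring automorphisms on a noetherian domain `S` and a proper ideal `𝔓`
  containing the rational prime `p`, every element of the first ramification group
  `G_1 = {σ | σ𝔓 = 𝔓, σ x ≡ x (mod 𝔓²) ∀ x}` has `p`-power order.
  Ref: Serre, *Local Fields*, Ch. IV §2, Cor. 3 of Prop. 7 ("`G_1` is a `p`-group").
* `Literature.NumberTheory.GaloisRepresentations.isPGroup_ramificationSubgroup_one_of_isGalois` — the case of a finite Galois `E/F`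
  inside `F̄` at `𝔓_E = 𝔓 ∩ E` (`S = ` integral closure of `𝒪[F]` in `E`, noetherian by
  `IsIntegralClosure.isNoetherian`, faithful action, `p ∈ 𝔓_E`).
* `Literature.NumberTheory.GaloisRepresentations.exists_isGalois_ker_le` — a continuous `f : Γ_F → H`, `H` discrete, factors through a
  finite *Galois* `Gal(E/F)`: the open kernel contains `Gal(F̄/E')` for a finite normal `E'`
  (Krull topology), and `Gal(F̄/E' ∩ F^{sep}) = Gal(F̄/E')` as `F̄/F^{sep}` is purely
  inseparable (`mem_fixingSubgroup_of_mem_fixingSubgroup_inf_separableClosure`).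
* the finite-level inclusion `G^v ≤ G_1` for `v > 0`
  (`upperRamificationSubgroup_le_ramificationSubgroup_one`, file `ModPGaloisRepProofs`).

## Proof that `G_1` is a `p`-group

Serre deduces Cor. 3 from the injections `G_i/G_{i+1} ↪ U_L^i/U_L^{i+1}` (Prop. 7), which need
a uniformiser of the discrete valuation ring `A_L`.  We use instead the following elementary
congruences, valid for any ideal `𝔓` (no valuation ring structure): if `τ ∈ G_i`, `i ≥ 1`
(`τ x ≡ x (mod 𝔓^{i+1})` for all `x`), then

1. `τ w ≡ w (mod 𝔓^{m+i})` for `w ∈ 𝔓^m` (`Ideal.smul_sub_mem_pow_add`; induction on `m`,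
   `τ(xy) - xy = (τx - x) τy + x (τy - y)`);
2. `τⁿ x ≡ x + n (τ x - x) (mod 𝔓^{2i+1})` (`Ideal.pow_smul_sub_mem`; induction on `n`, using 1
   for `y = τ x - x ∈ 𝔓^{i+1}`);
3. hence `τ^p ∈ G_{i+1}` when `p ∈ 𝔓` (`Ideal.pow_smul_sub_mem_of_natCast_mem`:
   `p (τx - x) ∈ 𝔓^{i+2}` and `2i + 1 ≥ i + 2`), and by induction `σ^{p^t} ∈ G_{t+1}` for
   `σ ∈ G_1` (`Ideal.pow_pow_smul_sub_mem`);
4. the `G_i` are eventually trivial (`Ideal.ramificationSubgroup_eventually_eq_bot_holds`: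
   Krull's intersection theorem and faithfulness), so `σ^{p^t} = 1` for `t ≫ 0`.

This is the content of Serre's Cor. 3 (and of the statement `(G_1 : 1)` is a power of `p`),
arranged to avoid the quotients `U^i/U^{i+1}`.

## References

* J.-P. Serre, *Local Fields*, GTM 67 (1979), Ch. IV §1 Prop. 1, §2 Prop. 7 and Cor. 3.
  [SerreLocalFields1979]
-/

noncomputable section

open scoped Pointwise Valued
open ValuativeRel

/-! ### Congruences for elements of `G_i` (Mathlib `Ideal` namespace, dot notation) -/

namespace Ideal

section Congruences

variable {S : Type*} [CommRing S] (𝔓 : Ideal S) {G : Type*} [Group G] [MulSemiringAction G S]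

/-- If `τ x ≡ x (mod 𝔓 ^ (i + 1))` for all `x` (the congruence defining `G_i`), then
`τ w ≡ w (mod 𝔓 ^ (m + i))` for all `w ∈ 𝔓 ^ m`.
Ref: Serre, *Local Fields*, Ch. IV §2, proof of Prop. 7. [folklore] -/
theorem smul_sub_mem_pow_add {τ : G} {i : ℕ} (hτ : ∀ x : S, τ • x - x ∈ 𝔓 ^ (i + 1)) :
    ∀ (m : ℕ) {w : S}, w ∈ 𝔓 ^ m → τ • w - w ∈ 𝔓 ^ (m + i) := by
  have hτ𝔓 : ∀ y ∈ 𝔓, τ • y ∈ 𝔓 := fun y hy => by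
    have : τ • y = (τ • y - y) + y := by ring
    rw [this]
    exact 𝔓.add_mem (Ideal.pow_le_self (Nat.succ_ne_zero i) (hτ y)) hy
  intro m
  induction m with
  | zero =>
    intro w _
    rw [zero_add]
    exact Ideal.pow_le_pow_right (Nat.le_succ i) (hτ w)
  | succ m ih =>
    intro w hw
    rw [pow_succ] at hw
    refine Submodule.mul_induction_on hw ?_ ?_
    · intro x hx y hy
      have key : τ • (x * y) - x * y = (τ • x - x) * τ • y + x * (τ • y - y) := by
        rw [smul_mul']; ring
      rw [key]
      refine Ideal.add_mem _ ?_ ?_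
      · have h1 : (τ • x - x) * τ • y ∈ 𝔓 ^ (m + i) * 𝔓 := Ideal.mul_mem_mul (ih hx) (hτ𝔓 y hy)
        rw [← pow_succ] at h1
        simpa [add_right_comm] using h1
      · have h2 : x * (τ • y - y) ∈ 𝔓 ^ m * 𝔓 ^ (i + 1) := Ideal.mul_mem_mul hx (hτ y)
        rw [← pow_add] at h2
        simpa [add_assoc, add_comm, add_left_comm] using h2
    · intro x y hx hy
      have : τ • (x + y) - (x + y) = (τ • x - x) + (τ • y - y) := by rw [smul_add]; ring
      rw [this]
      exact Ideal.add_mem _ hx hy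

/-- For `τ ∈ G_i`: `τⁿ x ≡ x + n (τ x - x) (mod 𝔓 ^ (2 i + 1))`.
Ref: Serre, *Local Fields*, Ch. IV §2, Prop. 7 ff. [folklore] -/
theorem pow_smul_sub_mem {τ : G} {i : ℕ} (hτ : ∀ x : S, τ • x - x ∈ 𝔓 ^ (i + 1))
    (n : ℕ) (x : S) : τ ^ n • x - x - (n : S) * (τ • x - x) ∈ 𝔓 ^ (2 * i + 1) := by
  induction n with
  | zero => simp
  | succ n ih =>
    set r := τ ^ n • x - x - (n : S) * (τ • x - x) with hr
    set y := τ • x - x with hy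
    have hy' : τ • y - y ∈ 𝔓 ^ (2 * i + 1) := by
      have := smul_sub_mem_pow_add 𝔓 hτ (i + 1) (hτ x)
      rw [← hy] at this
      simpa [two_mul, add_assoc, add_comm, add_left_comm] using this
    have hr' : τ • r - r ∈ 𝔓 ^ (2 * i + 1) :=
      Ideal.pow_le_pow_right (Nat.le_add_right _ _) (smul_sub_mem_pow_add 𝔓 hτ (2 * i + 1) ih)
    have hn : τ • (n : S) = n := map_natCast (MulSemiringAction.toRingHom G S τ) n
    have key : τ ^ (n + 1) • x - x - ((n + 1 : ℕ) : S) * (τ • x - x) =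
        (n : S) * (τ • y - y) + ((τ • r - r) + r) := by
      rw [pow_succ', mul_smul, hr, hy]
      simp only [smul_sub, smul_mul', hn, Nat.cast_succ]
      ring
    rw [key]
    exact Ideal.add_mem _ (Ideal.mul_mem_left _ _ hy') (Ideal.add_mem _ hr' ih)

/-- For `τ ∈ G_i`, `i ≥ 1`, and a natural number `p ∈ 𝔓`: `τ ^ p ∈ G_{i+1}`, i.e.
`τ^p x ≡ x (mod 𝔓 ^ (i + 2))` for all `x` (`τ^p x - x ≡ p (τx - x)` modulo `𝔓^{2i+1}`).
Ref: Serre, *Local Fields*, Ch. IV §2, Cor. 3 of Prop. 7. [folklore] -/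
theorem pow_smul_sub_mem_of_natCast_mem {τ : G} {i : ℕ} (hi : 1 ≤ i)
    (hτ : ∀ x : S, τ • x - x ∈ 𝔓 ^ (i + 1)) {p : ℕ} (hp : (p : S) ∈ 𝔓) (x : S) :
    τ ^ p • x - x ∈ 𝔓 ^ (i + 2) := by
  have h1 := pow_smul_sub_mem 𝔓 hτ p x
  have h2 : (p : S) * (τ • x - x) ∈ 𝔓 ^ (i + 2) := by
    have := Ideal.mul_mem_mul hp (hτ x)
    rwa [← pow_succ', show i + 1 + 1 = i + 2 by ring] at this
  have h3 : τ ^ p • x - x = (τ ^ p • x - x - (p : S) * (τ • x - x)) + (p : S) * (τ • x - x) := by ring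
  rw [h3]
  exact Ideal.add_mem _ (Ideal.pow_le_pow_right (by omega) h1) h2

/-- For `σ ∈ G_1` and a natural number `p ∈ 𝔓`: `σ ^ (p ^ t) ∈ G_{t+1}`, i.e.
`σ^{p^t} x ≡ x (mod 𝔓 ^ (t + 2))` for all `x` and `t`.
Ref: Serre, *Local Fields*, Ch. IV §2, Cor. 3 of Prop. 7. [folklore] -/
theorem pow_pow_smul_sub_mem {σ : G} (hσ : ∀ x : S, σ • x - x ∈ 𝔓 ^ 2) {p : ℕ} (hp : (p : S) ∈ 𝔓)
    (t : ℕ) (x : S) : σ ^ p ^ t • x - x ∈ 𝔓 ^ (t + 2) := by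
  induction t generalizing x with
  | zero => simpa using hσ x
  | succ t ih =>
    rw [show p ^ (t + 1) = p ^ t * p from pow_succ p t, pow_mul]
    exact pow_smul_sub_mem_of_natCast_mem 𝔓 (Nat.succ_pos t) (fun x => ih x) hp x

/-- Powers of an element stabilising `𝔓` stabilise `𝔓`. [folklore] -/
theorem pow_smul_eq_of_smul_eq {σ : G} (h : σ • 𝔓 = 𝔓) (n : ℕ) : σ ^ n • 𝔓 = 𝔓 := by
  induction n with
  | zero => rw [pow_zero, one_smul]
  | succ n ih => rw [pow_succ, mul_smul, h, ih]

end Congruences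

/-! ### `G_1` is a `p`-group -/

section PGroup

variable {S : Type*} [CommRing S] (𝔓 : Ideal S) (G : Type*) [Group G] [MulSemiringAction G S]

/-- **The first ramification group `G_1` is a `p`-group** (Serre, *Local Fields*, Ch. IV §2,
Cor. 3 of Prop. 7), for a finite group `G` acting faithfully by ring automorphisms on a
noetherian domain `S`, a proper ideal `𝔓` and a natural number `p` with `p ∈ 𝔓` (for the
valuation ring of a local field, `p` is the residue characteristic): every `σ ∈ G_1` satisfies
`σ ^ (p ^ t) = 1` for `t ≫ 0`, because `σ^{p^t} ∈ G_{t+1}` (`Ideal.pow_pow_smul_sub_mem`)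
and the `G_i` are eventually trivial (`Ideal.ramificationSubgroup_eventually_eq_bot_holds`).
[cite: SerreLocalFields1979, Ch. IV §2 Cor. 3 of Prop. 7] -/
theorem isPGroup_ramificationSubgroup_one [IsDomain S] [IsNoetherianRing S] [Finite G]
    [FaithfulSMul G S] (h𝔓 : 𝔓 ≠ ⊤) {p : ℕ} (hp : (p : S) ∈ 𝔓) :
    IsPGroup p (𝔓.ramificationSubgroup G 1) := by
  obtain ⟨N, hN⟩ := 𝔓.ramificationSubgroup_eventually_eq_bot_holds G h𝔓
  intro σ
  refine ⟨N, Subtype.ext ?_⟩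
  rw [Subgroup.coe_pow, Subgroup.coe_one]
  have hσ := σ.2
  rw [mem_ramificationSubgroup_iff] at hσ
  have hmem : (σ : G) ^ p ^ N ∈ 𝔓.ramificationSubgroup G (N + 1) := by
    rw [mem_ramificationSubgroup_iff]
    refine ⟨pow_smul_eq_of_smul_eq 𝔓 hσ.1 _, fun x => ?_⟩
    exact pow_pow_smul_sub_mem 𝔓 hσ.2 hp N x
  rw [hN (N + 1) (Nat.le_succ N)] at hmem
  exact Subgroup.mem_bot.mp hmem

end PGroup

end Ideal

/-! ### The local field case: `absUpperInertia_map_isPGroup` -/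

namespace Literature.NumberTheory.GaloisRepresentations

open GaloisRepresentations.IsNonarchimedeanLocalField Field

section WildImage

variable (F : Type*) [Field F] [ValuativeRel F] [TopologicalSpace F] [IsNonarchimedeanLocalField F]

omit [TopologicalSpace F] [IsNonarchimedeanLocalField F] in
/-- The Galois group of a finite subextension `E/F` of `F̄` acts faithfully on the integral
closure of `𝒪[F]` in `E` (every `y ∈ E` becomes integral after multiplication by a non-zero
`a ∈ 𝒪[F]`).  Ref: Serre, *Local Fields*, Ch. I §4. [folklore] -/
theorem faithfulSMul_algEquiv_integralClosure_intermediateField (E : IntermediateField F (AlgebraicClosure F))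
    [FiniteDimensional F E] : FaithfulSMul (E ≃ₐ[F] E) (integralClosure 𝒪[F] E) := by
  refine ⟨fun {σ τ} h => AlgEquiv.ext fun y => ?_⟩
  have halg : IsAlgebraic 𝒪[F] y := by
    have hy : IsAlgebraic F y := Algebra.IsAlgebraic.isAlgebraic y
    exact (IsFractionRing.isAlgebraic_iff 𝒪[F] F E).mpr hy |> fun h => h
  obtain ⟨a, ha, hint⟩ := halg.exists_integral_multiple
  have hx := h ⟨a • y, hint⟩
  have hx' : σ (a • y) = τ (a • y) := congrArg Subtype.val hx
  rw [Algebra.smul_def, map_mul, map_mul, IsScalarTower.algebraMap_apply 𝒪[F] F E,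
    AlgEquiv.commutes, AlgEquiv.commutes] at hx'
  have ha' : algebraMap F E (algebraMap 𝒪[F] F a) ≠ 0 := by
    rw [map_ne_zero, map_ne_zero_iff _ (IsFractionRing.injective 𝒪[F] F)]
    exact ha
  exact mul_left_cancel₀ ha' hx'

/-- For a finite *separable* subextension `E/F` of `F̄`, the integral closure of `𝒪[F]` in `E`
is a noetherian ring (it is a finite `𝒪[F]`-module, `IsIntegralClosure.isNoetherian`).
Ref: Serre, *Local Fields*, Ch. I §4, Prop. 8. [folklore] -/
theorem isNoetherianRing_integralClosure (E : IntermediateField F (AlgebraicClosure F))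
    [FiniteDimensional F E] [Algebra.IsSeparable F E] : IsNoetherianRing (integralClosure 𝒪[F] E) := by
  have h : IsNoetherian 𝒪[F] (integralClosure 𝒪[F] E) :=
    IsIntegralClosure.isNoetherian 𝒪[F] F E (integralClosure 𝒪[F] E)
  exact isNoetherian_of_tower 𝒪[F] h

/-- **The wild inertia group of a finite Galois `E/F` is a `p`-group**: for a finite Galois
subextension `E/F` of `F̄` and the prime `𝔓_E = 𝔓 ∩ E` below `𝔓 = absMaximalIdeal F`, the
first ramification group `G_1` of `Gal(E/F)` at `𝔓_E` is a `p`-group, `p = char 𝓀[F]`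
(`Ideal.isPGroup_ramificationSubgroup_one` with `p ∈ 𝔓_E`).
Ref: Serre, *Local Fields*, Ch. IV §2, Cor. 3 of Prop. 7.
[cite: SerreLocalFields1979, Ch. IV §2 Cor. 3 of Prop. 7] -/
theorem isPGroup_ramificationSubgroup_one_of_isGalois (E : IntermediateField F (AlgebraicClosure F))
    [FiniteDimensional F E] [IsGalois F E] :
    IsPGroup (ringChar 𝓀[F])
      (((absMaximalIdeal F).comap (E.integralClosureToAbsIntegers 𝒪[F])).ramificationSubgroup
        (E ≃ₐ[F] E) 1) := by
  haveI := faithfulSMul_algEquiv_integralClosure_intermediateField F E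
  haveI := isNoetherianRing_integralClosure F E
  refine Ideal.isPGroup_ramificationSubgroup_one _ (E ≃ₐ[F] E)
    (Ideal.comap_ne_top _ (absMaximalIdeal_ne_top F)) ?_
  rw [Ideal.mem_comap, map_natCast]
  exact IsFrobPow.natCast_ringChar_mem_absMaximalIdeal

omit [ValuativeRel F] [TopologicalSpace F] [IsNonarchimedeanLocalField F] in
/-- Automorphisms of `F̄/F` fixing the separable part `E ∩ F^{sep}` of a subfield `E ⊆ F̄`
pointwise fix `E` pointwise (`F̄/F^{sep}` is purely inseparable: `x^{qⁿ} ∈ F^{sep}`).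
Ref: Neukirch, *Algebraic Number Theory*, Ch. IV §1. [folklore] -/
theorem mem_fixingSubgroup_of_mem_fixingSubgroup_inf_separableClosure
    (E : IntermediateField F (AlgebraicClosure F)) (σ : AlgebraicClosure F ≃ₐ[F] AlgebraicClosure F)
    (hσ : σ ∈ (E ⊓ separableClosure F (AlgebraicClosure F)).fixingSubgroup) :
    σ ∈ E.fixingSubgroup := by
  rw [IntermediateField.mem_fixingSubgroup_iff] at hσ ⊢
  intro x hx
  set L := separableClosure F (AlgebraicClosure F) with hL
  set q := ringExpChar L with hq
  haveI : ExpChar (AlgebraicClosure F) q :=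
    expChar_of_injective_algebraMap (algebraMap L (AlgebraicClosure F)).injective q
  obtain ⟨n, y, hy⟩ := IsPurelyInseparable.pow_mem L q x
  have hmem : x ^ q ^ n ∈ E ⊓ L := by
    refine ⟨pow_mem hx _, ?_⟩
    rw [← hy]
    exact y.2
  have hfix : σ (x ^ q ^ n) = x ^ q ^ n := hσ _ hmem
  rw [map_pow] at hfix
  have h0 : (σ x - x) ^ q ^ n = 0 := by rw [sub_pow_expChar_pow, hfix, sub_self]
  exact sub_eq_zero.mp (pow_eq_zero_iff (pow_ne_zero n (expChar_pos (AlgebraicClosure F) q).ne') |>.mp h0)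

omit [ValuativeRel F] [TopologicalSpace F] [IsNonarchimedeanLocalField F] in
/-- **A continuous homomorphism from `Γ_F` to a discrete group factors through a finite Galois
group**: there is a finite Galois subextension `E/F` of `F̄` such that the kernel of the
restriction `Γ_F → Gal(E/F)` is contained in the kernel of `f` (the kernel of `f` is open, so it
contains `Gal(F̄/E')` for a finite normal `E'`, and `Gal(F̄/E' ∩ F^{sep}) = Gal(F̄/E')`).
Ref: Neukirch, *Algebraic Number Theory*, Ch. IV §1, (1.2) (open subgroups ↔ finite
subextensions). [folklore] -/
theorem exists_isGalois_ker_le {H : Type*} [Group H] [TopologicalSpace H] [DiscreteTopology H]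
    (f : absoluteGaloisGroup F →ₜ* H) :
    ∃ E : IntermediateField F (AlgebraicClosure F), ∃ (_ : FiniteDimensional F E) (_ : IsGalois F E),
      (absRestrictNormalHom (K := F) E).ker ≤ f.toMonoidHom.ker := by
  -- the kernel of `f` is an open neighbourhood of `1`
  have hopen : IsOpen ((f.toMonoidHom.ker : Subgroup (absoluteGaloisGroup F)) : Set (absoluteGaloisGroup F)) := by
    rw [MonoidHom.coe_ker]
    exact (isOpen_discrete ({1} : Set H)).preimage f.continuous_toFun
  have hnhds : ((f.toMonoidHom.ker : Subgroup (absoluteGaloisGroup F)) : Set (absoluteGaloisGroup F)) ∈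
      nhds (1 : absoluteGaloisGroup F) := hopen.mem_nhds (one_mem _)
  obtain ⟨E', hfin, hnorm, hE'⟩ :=
    (krullTopology_mem_nhds_one_iff_of_normal F (AlgebraicClosure F) _).mp hnhds
  -- shrink to the separable part `E = E' ∩ F^{sep}`
  haveI := hfin
  haveI := hnorm
  haveI hfinE : FiniteDimensional F (E' ⊓ separableClosure F (AlgebraicClosure F) :
      IntermediateField F (AlgebraicClosure F)) :=
    FiniteDimensional.of_injective
      (IntermediateField.inclusion (inf_le_left : E' ⊓ separableClosure F (AlgebraicClosure F) ≤ E')).toLinearMap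
      (IntermediateField.inclusion_injective
        (inf_le_left : E' ⊓ separableClosure F (AlgebraicClosure F) ≤ E'))
  haveI hsepE : Algebra.IsSeparable F (E' ⊓ separableClosure F (AlgebraicClosure F) :
      IntermediateField F (AlgebraicClosure F)) :=
    (le_separableClosure_iff F (AlgebraicClosure F) _).mp inf_le_right
  haveI hnormE : Normal F (E' ⊓ separableClosure F (AlgebraicClosure F) :
      IntermediateField F (AlgebraicClosure F)) := inferInstance
  haveI hgalE : IsGalois F (E' ⊓ separableClosure F (AlgebraicClosure F) :
      IntermediateField F (AlgebraicClosure F)) := ⟨⟩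
  refine ⟨E' ⊓ separableClosure F (AlgebraicClosure F), hfinE, hgalE, fun σ hσ => ?_⟩
  have hσ' : absoluteGaloisGroup.toAlgEquiv F σ ∈
      (E' ⊓ separableClosure F (AlgebraicClosure F)).fixingSubgroup := by
    rw [← IntermediateField.restrictNormalHom_ker]
    exact hσ
  exact hE' (mem_fixingSubgroup_of_mem_fixingSubgroup_inf_separableClosure F E' _ hσ')

/-- **Discharge of `absUpperInertia_map_isPGroup`**: for `v > 0` the image of `I_F^v` under a
continuous homomorphism `f : Γ_F → H` into a discrete group is a `p`-group.  Proof: `f` factors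
through a finite Galois `Gal(E/F)` (`exists_isGalois_ker_le`); the restriction of
`σ ∈ I_F^v` lies in `Gal(E/F)^v ≤ Gal(E/F)_1`
(`upperRamificationSubgroup_le_ramificationSubgroup_one`), a `p`-group
(`isPGroup_ramificationSubgroup_one_of_isGalois`), so `σ^{p^t}` restricts trivially to `E`,
hence `f(σ)^{p^t} = 1`.
Ref: Serre, *Local Fields*, Ch. IV §2, Cor. 3 of Prop. 7 and §3, Remark 1; Serre, Invent.
Math. 15 (1972), §1.2. [cite: SerreLocalFields1979, Ch. IV §2 Cor. 3 of Prop. 7 and §3 Remark 1] -/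
theorem absUpperInertia_map_isPGroup_holds (H : Type*) [Group H] [TopologicalSpace H] :
    absUpperInertia_map_isPGroup F H := by
  intro _ f v hv
  obtain ⟨E, hfin, hgal, hker⟩ := exists_isGalois_ker_le F f
  have hG1 := isPGroup_ramificationSubgroup_one_of_isGalois F E
  rintro ⟨_, σ, hσ, rfl⟩
  have h1 := (mem_absUpperRamificationSubgroup_iff.mp hσ) E
  have h2 := upperRamificationSubgroup_le_ramificationSubgroup_one
    ((absMaximalIdeal F).comap (E.integralClosureToAbsIntegers 𝒪[F])) (E ≃ₐ[F] E) hv h1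
  obtain ⟨t, ht⟩ := hG1 ⟨_, h2⟩
  refine ⟨t, Subtype.ext ?_⟩
  have hmem : σ ^ ringChar 𝓀[F] ^ t ∈ (absRestrictNormalHom (K := F) E).ker := by
    rw [MonoidHom.mem_ker, map_pow]
    exact congrArg Subtype.val ht
  have := hker hmem
  rw [MonoidHom.mem_ker, map_pow] at this
  rw [Subgroup.coe_pow, Subgroup.coe_one]
  exact this

end WildImage

end Literature.NumberTheory.GaloisRepresentations
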